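import Summits.Ventures.PercRepro.RLSRuleTypeZero

/-!
# C-025 at q = 3: lines of a plane on the core (night-3, gen 4)

On a core matroid (`Core`: simple, coloop-free, every element with an `e`-free partition) there is NO `4`-point
line (`not_hasLongLine_of_core`: three points of a `4`-point line through `e` fall two on one side of any partition of
`E ∖ {e}`, and `e` lies in that side's closure — mine-4's remark of 08:12Z made kernel); two distinct `3`-point lines
of a simple set without a `4`-line meet in at most one point (`card_inter_le_one_of_lines`); hence a plane with at
most `5` points has at most two `3`-point lines (`card_depTriples_le_two_of_card_le_five`: a third line would lie
inside the union of the first two).  Imports `RLSRuleTypeZero`.  Axioms: standard.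
-/

open scoped Matroid

namespace PercRepro

namespace NightThree

open Finset ThmH PerFlat

variable {α : Type*} [DecidableEq α] {M : Matroid α} [M.Finite]

/-- On a core matroid no subset of the ground set contains a `4`-point line. -/
theorem not_hasLongLine_of_core {p : ℕ} (hc : Core M p) {F : Finset α} (hF : F ⊆ gr M) :
    ¬ HasLongLine M F := by
  classical
  rintro ⟨L, hL, hr⟩
  rw [Finset.mem_powersetCard] at hL
  obtain ⟨hLF, hLc⟩ := hL
  have hLG : L ⊆ gr M := hLF.trans hF
  have hLE : (L : Set α) ⊆ M.E := by rw [← coe_gr M]; exact Finset.coe_subset.2 hLG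
  obtain ⟨e, he⟩ : ∃ e, e ∈ L := Finset.card_pos.1 (by omega)
  have heE : e ∈ M.E := hLE (Finset.mem_coe.2 he)
  obtain ⟨A, hAE, heA, heA'⟩ := hc.2.2.2 e heE
  -- the three other points of `L`; two of them on one side of the partition
  set L' := L.erase e with hL'
  have hL'c : L'.card = 3 := by rw [hL', Finset.card_erase_of_mem he, hLc]
  have hsplit : 2 ≤ (L'.filter (fun x => x ∈ A)).card ∨ 2 ≤ (L'.filter (fun x => x ∉ A)).card := by
    have := Finset.card_filter_add_card_filter_not (s := L') (fun x => x ∈ A)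
    omega
  -- a pair `{u, v}` on one side: its closure contains `L`, hence `e`
  have key : ∀ P ⊆ L', P.card = 2 → e ∈ M.closure (P : Set α) := by
    intro P hPL' hPc
    obtain ⟨u, v, huv, rfl⟩ := Finset.card_eq_two.1 hPc
    have hPL : ({u, v} : Finset α) ⊆ L := hPL'.trans (Finset.erase_subset _ _)
    have hPr : M.eRk (({u, v} : Finset α) : Set α) = 2 := by
      rw [Finset.coe_pair]
      exact hc.1 u (hLE (Finset.mem_coe.2 (hPL (by simp)))) v (hLE (Finset.mem_coe.2 (hPL (by simp)))) huv
    have hcl : M.closure (({u, v} : Finset α) : Set α) = M.closure (L : Set α) :=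
      closure_eq_of_subset_flat (M.isFlat_closure _)
        ((Finset.coe_subset.2 hPL).trans (M.subset_closure _ hLE)) (Finset.finite_toSet _)
        (by rw [M.eRk_closure_eq, hPr]; exact hr)
    rw [hcl]
    exact M.subset_closure _ hLE (Finset.mem_coe.2 he)
  rcases hsplit with h2 | h2
  · obtain ⟨P, hP, hPc⟩ := Finset.exists_subset_card_eq h2
    have hPA : (P : Set α) ⊆ A := by
      intro x hx
      exact (Finset.mem_filter.1 (hP (Finset.mem_coe.1 hx))).2
    exact heA (M.closure_mono hPA (key P (hP.trans (Finset.filter_subset _ _)) hPc))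
  · obtain ⟨P, hP, hPc⟩ := Finset.exists_subset_card_eq h2
    have hPA : (P : Set α) ⊆ (M.E \ {e}) \ A := by
      intro x hx
      have hx' := Finset.mem_filter.1 (hP (Finset.mem_coe.1 hx))
      have hxL' : x ∈ L' := hx'.1
      rw [hL', Finset.mem_erase] at hxL'
      exact ⟨⟨hLE (Finset.mem_coe.2 hxL'.2), fun h => hxL'.1 (Set.mem_singleton_iff.1 h)⟩, hx'.2⟩
    exact heA' (M.closure_mono hPA (key P (hP.trans (Finset.filter_subset _ _)) hPc))

/-- Two distinct `3`-point lines of a simple set without a `4`-point line meet in at most one point. -/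
theorem card_inter_le_one_of_lines {G ℓ ℓ' : Finset α} (hsimple : SimpleOn M G) (hlong : ¬ HasLongLine M G)
    (hGE : G ⊆ gr M) (hℓG : ℓ ⊆ G) (hℓ'G : ℓ' ⊆ G) (hℓc : ℓ.card = 3) (hℓ'c : ℓ'.card = 3)
    (hℓr : M.eRk (ℓ : Set α) = 2) (hℓ'r : M.eRk (ℓ' : Set α) = 2) (hne : ℓ ≠ ℓ') : (ℓ ∩ ℓ').card ≤ 1 := by
  classical
  by_contra hc
  push Not at hc
  have hc2 : (ℓ ∩ ℓ').card ≤ 2 := by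
    by_contra hc2
    push Not at hc2
    have heq : ℓ ∩ ℓ' = ℓ := Finset.eq_of_subset_of_card_le Finset.inter_subset_left (by omega)
    have heq' : ℓ ∩ ℓ' = ℓ' := Finset.eq_of_subset_of_card_le Finset.inter_subset_right (by omega)
    exact hne (heq.symm.trans heq')
  have h1 := Finset.card_union_add_card_inter ℓ ℓ'
  have hu4 : (ℓ ∪ ℓ').card = 4 := by omega
  obtain ⟨P, hPsub, hPc⟩ := Finset.exists_subset_card_eq hc
  have hPℓ : P ⊆ ℓ := hPsub.trans Finset.inter_subset_left
  have hPℓ' : P ⊆ ℓ' := hPsub.trans Finset.inter_subset_right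
  obtain ⟨u, v, huv, rfl⟩ := Finset.card_eq_two.1 hPc
  have hPr : M.eRk (({u, v} : Finset α) : Set α) = 2 := by
    rw [Finset.coe_pair]
    exact hsimple u (hℓG (hPℓ (by simp))) v (hℓG (hPℓ (by simp))) huv
  have hℓE : (ℓ : Set α) ⊆ M.E := by
    rw [← coe_gr M]; exact Finset.coe_subset.2 (hℓG.trans hGE)
  have hℓ'E : (ℓ' : Set α) ⊆ M.E := by
    rw [← coe_gr M]; exact Finset.coe_subset.2 (hℓ'G.trans hGE)
  have hcl : M.closure (({u, v} : Finset α) : Set α) = M.closure (ℓ : Set α) :=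
    closure_eq_of_subset_flat (M.isFlat_closure _)
      ((Finset.coe_subset.2 hPℓ).trans (M.subset_closure _ hℓE)) (Finset.finite_toSet _)
      (by rw [M.eRk_closure_eq, hPr, hℓr])
  have hcl' : M.closure (({u, v} : Finset α) : Set α) = M.closure (ℓ' : Set α) :=
    closure_eq_of_subset_flat (M.isFlat_closure _)
      ((Finset.coe_subset.2 hPℓ').trans (M.subset_closure _ hℓ'E)) (Finset.finite_toSet _)
      (by rw [M.eRk_closure_eq, hPr, hℓ'r])
  -- `ℓ ∪ ℓ′` is a `4`-point set of rank `≤ 2`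
  have hUsub : ((ℓ ∪ ℓ' : Finset α) : Set α) ⊆ M.closure (ℓ : Set α) := by
    intro x hx
    rw [Finset.coe_union] at hx
    rcases hx with hxℓ | hxℓ'
    · exact M.subset_closure _ hℓE hxℓ
    · rw [← hcl, hcl']
      exact M.subset_closure _ hℓ'E hxℓ'
  have hUr : M.eRk ((ℓ ∪ ℓ' : Finset α) : Set α) ≤ 2 := by
    have := M.eRk_mono hUsub
    rwa [M.eRk_closure_eq, hℓr] at this
  exact hlong ⟨ℓ ∪ ℓ', Finset.mem_powersetCard.2 ⟨Finset.union_subset hℓG hℓ'G, hu4⟩, hUr⟩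

/-- A simple plane with at most `5` points and no `4`-point line has at most two dependent triples. -/
theorem card_depTriples_le_two_of_card_le_five {G : Finset α} (hsimple : SimpleOn M G) (hlong : ¬ HasLongLine M G)
    (hGE : G ⊆ gr M) (hG5 : G.card ≤ 5) : (depTriples M G).card ≤ 2 := by
  classical
  by_contra hc
  push Not at hc
  obtain ⟨T, hTsub, hTc⟩ := Finset.exists_subset_card_eq (show 3 ≤ (depTriples M G).card by omega)
  obtain ⟨ℓ1, ℓ2, ℓ3, h12, h13, h23, rfl⟩ := Finset.card_eq_three.1 hTc
  have hmem : ∀ m ∈ ({ℓ1, ℓ2, ℓ3} : Finset (Finset α)), m ⊆ G ∧ m.card = 3 ∧ M.eRk (m : Set α) = 2 := by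
    intro m hm
    have := hTsub hm
    unfold depTriples at this
    rw [Finset.mem_filter, Finset.mem_powersetCard] at this
    exact ⟨this.1.1, this.1.2, eRk_eq_two_of_dep_triple hsimple this.1.1 this.1.2 this.2⟩
  obtain ⟨h1G, h1c, h1r⟩ := hmem ℓ1 (by simp)
  obtain ⟨h2G, h2c, h2r⟩ := hmem ℓ2 (by simp)
  obtain ⟨h3G, h3c, h3r⟩ := hmem ℓ3 (by simp)
  have hi12 := card_inter_le_one_of_lines hsimple hlong hGE h1G h2G h1c h2c h1r h2r h12
  have hi13 := card_inter_le_one_of_lines hsimple hlong hGE h1G h3G h1c h3c h1r h3r h13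
  have hi23 := card_inter_le_one_of_lines hsimple hlong hGE h2G h3G h2c h3c h2r h3r h23
  -- `ℓ1 ∪ ℓ2 = G`
  have hu := Finset.card_union_add_card_inter ℓ1 ℓ2
  have hUG : ℓ1 ∪ ℓ2 = G :=
    Finset.eq_of_subset_of_card_le (Finset.union_subset h1G h2G) (by omega)
  -- `ℓ3 ⊆ ℓ1 ∪ ℓ2` meets each in at most one point
  have h3split : ℓ3 = (ℓ3 ∩ ℓ1) ∪ (ℓ3 ∩ ℓ2) := by
    rw [← Finset.inter_union_distrib_left, hUG, Finset.inter_eq_left.2 h3G]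
  have h3le : ℓ3.card ≤ (ℓ3 ∩ ℓ1).card + (ℓ3 ∩ ℓ2).card := by
    have := Finset.card_union_le (ℓ3 ∩ ℓ1) (ℓ3 ∩ ℓ2)
    rwa [← h3split] at this
  rw [Finset.inter_comm ℓ3 ℓ1] at h3le
  rw [Finset.inter_comm ℓ3 ℓ2] at h3le
  omega

end NightThree

end PercRepro
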